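import Literature.MathematicalPhysics.QuantumFieldTheory.BalabanImbrieJaffe1984to88.BIJ88Eq596Display

/-!
# `BalabanImbrieJaffe1984to88.BIJ88Eq5128Split` — T. Bałaban, J. Imbrie, A. Jaffe, *Effective action and cluster properties of the
abelian Higgs model*, Commun. Math. Phys. **114** (1988) 257–315 [BalabanImbrieJaffe1988], Sect. 5.12 *Conditional Integration*, p. 300
[PDF 44] *"We exploit the simple structure in Λ^{(k)}_{10} by doing the integrals there with conditioning on Λ^{(k)c}_{10}, Λ^{(k)c*c}_{10}"* and
the first line of **(5.12.8)** p. 303 [PDF 47] *"∫ Π_{j=0}^{k} du^{(j)}|_{Λ^{(j)c*}_{10}} dφ^{(k)}|_{Λ^{(k)c}_{10}} …"* — **THE EXTERIOR/INTERIOR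
SPLITTING OF THE CONFIGURATION MEASURE OF ONE TERM**, proved for the product measures of the torus carriers.

statement-level skeleton of published theorems with citation tags; proofs where landed; nothing here is a claim about the Yang–Mills mass gap

WHAT THIS FILE DOES (measure level; file 2 of the (5.12.8) set of seat p34 gen 10).  The configuration of one term of the translated display
(5.9.6) (this seat's `BIJ88Eq596Display.IsDT`), apart from the spectators `v′` (the freed block gauge field) and `ψ`, is
`q = (u, {u^{(j)}}_{j<k}, φ^{(k)}) ∈ Cfg P k := GaugeField P k U1 × (Prev P k × HiggsField P k)` with the PRODUCT measure
`ν ⊗ Π_{j<k}𝒟u^{(j)} ⊗ 𝒟φ^{(k)}` (`cfgMeasure ν`; `ν = 𝒟u` or `𝒟u δ_{Ax}`, both products of one-bond laws: `fieldMeasure_eq_pi`, `axialMeasure_eq_pi`).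
Sect. 5.12 integrates the variables INSIDE the region `Λ^{(k)}_{10}` — the bond variables of `Λ^{(k)c*c}_{10}` (of `Λ^{(j)c*c}_{10}` for the previous
fields) and the site variables of `Λ^{(k)}_{10}` — *with conditioning on* the variables outside.  Given the INTERIOR index sets of a term
(`Interior`: `Ib`, `Ip j`, `Ix`; print: `Λ^{(k)c*c}_{10}`, `Λ^{(j)c*c}_{10}`, `Λ^{(k)}_{10}`), this file constructs the measurable equivalence
`split : Cfg P k ≃ᵐ Ext × Int` (restriction of each field to the exterior and to the interior index sets; Mathlib's `piEquivPiSubtypeProd` per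
field, regrouped) and PROVES it carries the configuration measure to the product of the EXTERIOR measure `μExt` (= *"Π_{j=0}^{k} du^{(j)}|_{Λ^{(j)c*}_{10}}
dφ^{(k)}|_{Λ^{(k)c}_{10}}"* of line 1 of (5.12.8)) and the INTERIOR measure `μInt` (= the `dA^{(k)″}|_{Λ^{(k)c*c}_{10}} dφ^{(k)″}|_{Λ^{(k)}_{10}}` of
(5.12.7) together with the previous interior bond variables that (5.12.3) integrates): `measurePreserving_split`.  It also provides the maps
through which the display (5.12.8) is written on the full configuration space: `glue` (inverse of `split`), `freeze` (interior variables set to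
`1`/`0` — the exterior bracket of (5.12.8) is a function of `freeze q`), the exterior measure pushed to `Cfg P k` (`extMeasure`, *interior variables
carried as frozen dummies*), the fibre laws `fibreMeasure`, and their integration formulae.

READING (declared).  Unitary bond variables are kept (`u_b ∈ U(1)` with the Haar/Dirac one-bond laws); the print's `dA^{(k)″}` is the chart
`u = e^{iηe_kA}` on the small-field interior (p. 301: *"The factors e_k/2π come from the replacement of du^{(k)} with dA^{(k)} for the free variables"*)
and is NOT performed here; the `δ`-function constraints of `u^{(k)}` are implemented, as in gens 5–9, by the translated reading `u^{(k)} = u′_Λ(u)`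
(`uCut`) of a free `u ~ ν`, so the interior/exterior split is of the bond variables of `u` (the file states no claim about which blocks' constraints
are interior: that is the locality hypothesis of `BIJ88Eq5128Frame`).

CITATION HEADER (lean-in-tree rule).  Part of the lit-balaban TYPED SKELETON (HOME `run/shared/lean/pub/lit-balaban/`), PHASE-2 proof seat p34
gen 10 (unit `lit-balaban-p34-g10`; TAKING line HOME/STATUS.md 2026-08-22T00:14:36Z).  Row served: **`C2.Eq5.12.8`** of
`HOME/lit-balaban-r16/ROWS-C2-part2.md` (owner r16; first line of the display), support `C2.Eq5.12.1-5.12.7`.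
PDF held: `paper:balaban1988-cmp114-bij-abelian-higgs-effective-action` (journal page = PDF page + 256); pp. 300–303 rendered and read this session
(`renders/c2-p044.png` … `c2-p047.png`).
WHAT IS PROVED: definitions with bodies (the index data, the split, the measures, `glue`/`freeze`/`base`) + theorems; 0 `sorry`; no `Prop`-valued
fact; standard axioms.  Imports this seat's `BIJ88Eq596Display` (carriers, `uCut`/`vCut`); Mathlib otherwise.
-/

namespace Literature.MathematicalPhysics.QuantumFieldTheory.BalabanImbrieJaffe1984to88.BIJ88Eq5128Split

open Literature.MathematicalPhysics.QuantumFieldTheory.Balaban1983to89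
open BIJ88Sect3Statements (U1)
open BIJ85Sect1Model (HiggsField)
open BIJ88RenormTransf311 (axialMeasure axialBonds)
open BIJ88InductiveForm41 (Prev prevMeasure)
open T4AxialGaugeFixing (fixBonds fixBonds_apply_of_mem fixBonds_apply_of_not_mem measurable_fixBonds)
open scoped BigOperators ENNReal
open _root_.MeasureTheory _root_.MeasureTheory.Measure Function Set

noncomputable section

/-! ## §1 Two regroupings of product measures (plumbing) -/

section Generic

variable {α β γ δ : Type*} [MeasurableSpace α] [MeasurableSpace β] [MeasurableSpace γ] [MeasurableSpace δ]

/-- `((a, b), (c, d)) ↦ ((a, c), (b, d))` as a measurable equivalence (Mathlib has the `Equiv`). [folklore] -/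
def prodProdProdComm : (α × β) × (γ × δ) ≃ᵐ (α × γ) × (β × δ) where
  toEquiv := Equiv.prodProdProdComm α β γ δ
  measurable_toFun :=
    (measurable_fst.fst.prodMk measurable_snd.fst).prodMk (measurable_fst.snd.prodMk measurable_snd.snd)
  measurable_invFun :=
    (measurable_fst.fst.prodMk measurable_snd.fst).prodMk (measurable_fst.snd.prodMk measurable_snd.snd)

/-- kernel: the value of the regrouping. [folklore] -/
private theorem prodProdProdComm_apply (p : (α × β) × (γ × δ)) :
    (prodProdProdComm : (α × β) × (γ × δ) ≃ᵐ (α × γ) × (β × δ)) p = ((p.1.1, p.2.1), (p.1.2, p.2.2)) := rfl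

/-- **The regrouping `((a,b),(c,d)) ↦ ((a,c),(b,d))` preserves product measures** (composition of Mathlib's associators and the swap).
[folklore] -/
private theorem measurePreserving_prodProdProdComm (μa : Measure α) (μb : Measure β) (μc : Measure γ) (μd : Measure δ)
    [SFinite μa] [SFinite μb] [SFinite μc] [SFinite μd] :
    MeasurePreserving (prodProdProdComm : (α × β) × (γ × δ) ≃ᵐ (α × γ) × (β × δ))
      ((μa.prod μb).prod (μc.prod μd)) ((μa.prod μc).prod (μb.prod μd)) := by
  have h1 := measurePreserving_prodAssoc μa μb (μc.prod μd)
  have h2 := (measurePreserving_prodAssoc μb μc μd).symm MeasurableEquiv.prodAssoc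
  have h3 : MeasurePreserving (Prod.map Prod.swap id) ((μb.prod μc).prod μd) ((μc.prod μb).prod μd) :=
    (Measure.measurePreserving_swap (μ := μb) (ν := μc)).prod (MeasurePreserving.id μd)
  have h4 := measurePreserving_prodAssoc μc μb μd
  have h5 : MeasurePreserving
      (Prod.map (id : α → α) ((MeasurableEquiv.prodAssoc : (γ × β) × δ ≃ᵐ γ × β × δ) ∘ Prod.map Prod.swap id ∘
        (MeasurableEquiv.prodAssoc : (β × γ) × δ ≃ᵐ β × γ × δ).symm))
      (μa.prod (μb.prod (μc.prod μd))) (μa.prod (μc.prod (μb.prod μd))) :=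
    (MeasurePreserving.id μa).prod (h4.comp (h3.comp h2))
  have h6 := (measurePreserving_prodAssoc μa μc (μb.prod μd)).symm MeasurableEquiv.prodAssoc
  have h := h6.comp (h5.comp h1)
  convert h using 1
  funext p
  rfl

variable {ι : Type*} [Fintype ι] {X Y : ι → Type*} [∀ i, MeasurableSpace (X i)] [∀ i, MeasurableSpace (Y i)]

/-- `Π_i (X_i × Y_i) ≃ (Π_i X_i) × (Π_i Y_i)` as a measurable equivalence — the dependent version of Mathlib's `arrowProdEquivProdArrow`.
[folklore] -/
def piProdSplit : ((i : ι) → X i × Y i) ≃ᵐ ((i : ι) → X i) × ((i : ι) → Y i) where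
  toEquiv := Equiv.arrowProdEquivProdArrow ι X Y
  measurable_toFun := (measurable_pi_lambda _ fun i => (measurable_pi_apply i).fst).prodMk
    (measurable_pi_lambda _ fun i => (measurable_pi_apply i).snd)
  measurable_invFun := measurable_pi_lambda _ fun i =>
    ((measurable_pi_apply i).comp measurable_fst).prodMk ((measurable_pi_apply i).comp measurable_snd)

/-- **`Π_i (μ_i ⊗ ν_i) ≅ (Π_i μ_i) ⊗ (Π_i ν_i)`** along `piProdSplit` (Mathlib's proof of `measurePreserving_arrowProdEquivProdArrow`, dependent).
[folklore] -/
private theorem measurePreserving_piProdSplit (μ : ∀ i, Measure (X i)) (ν : ∀ i, Measure (Y i)) [∀ i, SigmaFinite (μ i)]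
    [∀ i, SigmaFinite (ν i)] :
    MeasurePreserving (piProdSplit : ((i : ι) → X i × Y i) ≃ᵐ _) (Measure.pi fun i => (μ i).prod (ν i))
      ((Measure.pi μ).prod (Measure.pi ν)) where
  measurable := piProdSplit.measurable
  map_eq := by
    refine (FiniteSpanningSetsIn.ext ?_ (isPiSystem_pi.prod isPiSystem_pi)
      ((FiniteSpanningSetsIn.pi fun i ↦ (μ i).toFiniteSpanningSetsIn).prod
      (FiniteSpanningSetsIn.pi (fun i ↦ (ν i).toFiniteSpanningSetsIn))) ?_).symm
    · refine (generateFrom_eq_prod generateFrom_pi generateFrom_pi ?_ ?_).symm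
      · exact (FiniteSpanningSetsIn.pi (fun i ↦ (μ i).toFiniteSpanningSetsIn)).isCountablySpanning
      · exact (FiniteSpanningSetsIn.pi (fun i ↦ (ν i).toFiniteSpanningSetsIn)).isCountablySpanning
    · rintro _ ⟨s, ⟨s, _, rfl⟩, ⟨_, ⟨t, _, rfl⟩, rfl⟩⟩
      rw [MeasurableEquiv.map_apply]
      rw [show (piProdSplit : ((i : ι) → X i × Y i) ≃ᵐ _) ⁻¹' (univ.pi s ×ˢ univ.pi t) = (univ.pi fun i ↦ s i ×ˢ t i) by
          ext f
          simp only [mem_preimage, mem_prod, mem_univ_pi, forall_and]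
          rfl]
      simp_rw [pi_pi, prod_prod, pi_pi, Finset.prod_mul_distrib]

end Generic

/-! ## §2 The configuration of one term and its interior index sets -/

-- The finite index sets below are subtypes `{b // b ∈ s}` of finsets; Mathlib's `piEquivPiSubtypeProd` lemmas carry the generic
-- `Subtype.fintype` instance, so we give it priority here to keep all `Measure.pi`'s over such subtypes syntactically comparable.
attribute [local instance 1001] Subtype.fintype

variable {P : Params} {k : ℕ}

/-- The bond variables of the translated gauge field `u^{(k)}` of one term, as a plain product type (= `GaugeField P k U1` definitionally; the
product form lets Mathlib's product-measure lemmas act on it). [cite: BalabanImbrieJaffe1988, (5.12.8) p.303] -/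
abbrev UCfg (P : Params) (k : ℕ) : Type := PBond P k → U1

/-- The previous fields `{u^{(j)}}_{j<k}` of one term, as a plain product type (= `Prev P k` definitionally). [cite: BalabanImbrieJaffe1988, (5.12.8) p.303] -/
abbrev PCfg (P : Params) (k : ℕ) : Type := (j : Fin k) → (PBond P j → U1)

/-- The configuration of one term of (5.9.6)/(5.12.8) apart from the spectators `v′`, `ψ`: `q = (u, {u^{(j)}}_{j<k}, φ^{(k)})` (the bracket reads
`u^{(k)} = u′_Λ(u)`); definitionally `GaugeField P k U1 × (Prev P k × HiggsField P k)`. [cite: BalabanImbrieJaffe1988, (5.12.8) p.303] -/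
abbrev Cfg (P : Params) (k : ℕ) : Type := UCfg P k × (PCfg P k × HiggsField P k)

/-- `Π_{j<k} 𝒟u^{(j)}` written as a product of products (= r18's `prevMeasure P k` definitionally: `prevMeasure_eq_prevPi`).
[cite: BalabanImbrieJaffe1988, (4.1) p.274] -/
def prevPi (P : Params) (k : ℕ) : Measure (PCfg P k) :=
  Measure.pi fun j : Fin k => Measure.pi fun _ : PBond P j => (HaarData.haar : Measure U1)

/-- kernel: `prevPi` IS `Π_{j<k}𝒟u^{(j)}`. [cite: BalabanImbrieJaffe1988, (4.1) p.274] -/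
theorem prevMeasure_eq_prevPi : (prevMeasure P k : Measure (PCfg P k)) = prevPi P k := rfl

/-- **The law `𝒟u` is the product of the one-bond Haar measures** (definitional). [cite: BalabanImbrieJaffe1988, (5.12.8) p.303] -/
theorem fieldMeasure_eq_pi : (fieldMeasure P k U1 : Measure (UCfg P k)) = Measure.pi fun _ : PBond P k => (HaarData.haar : Measure U1) := rfl

/-- The configuration measure `ν ⊗ Π_{j<k}𝒟u^{(j)} ⊗ 𝒟φ^{(k)}` of one term (`ν` the law of `u`). [cite: BalabanImbrieJaffe1988, (5.12.8) p.303] -/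
def cfgMeasure (ν : Measure (UCfg P k)) : Measure (Cfg P k) :=
  ν.prod ((prevPi P k).prod (volume : Measure (HiggsField P k)))

/-- kernel (plumbing): sigma-finiteness of the Haar data of `U(1)` (a probability measure). [folklore] -/
instance sigmaFinite_haarU1 : SigmaFinite (HaarData.haar : Measure U1) := by
  haveI := (HaarData.isProb : IsProbabilityMeasure (HaarData.haar : Measure U1)); infer_instance

/-- kernel (plumbing): `Π_{j<k}𝒟u^{(j)}` is a probability measure. [cite: BalabanImbrieJaffe1988, (4.1) p.274] -/
instance isProbabilityMeasure_prevPi : IsProbabilityMeasure (prevPi P k) := by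
  haveI := (HaarData.isProb : IsProbabilityMeasure (HaarData.haar : Measure U1))
  unfold prevPi; infer_instance

/-- kernel (plumbing): the configuration measure is s-finite. [cite: BalabanImbrieJaffe1988, (5.12.8) p.303] -/
instance sFinite_cfgMeasure (ν : Measure (UCfg P k)) [SFinite ν] : SFinite (cfgMeasure (P := P) (k := k) ν) := by
  unfold cfgMeasure; infer_instance

/-- **The law `∫𝒟u δ_{Ax}(u)(·)` is a product of one-bond laws**: Dirac mass at `1` on the tree bonds, Haar measure on the others (r18's
`axialMeasure` is the push-forward of `𝒟u` under freezing the tree bonds, bond by bond). [cite: BalabanImbrieJaffe1988, (3.11) p.266] -/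
theorem axialMeasure_eq_pi :
    (axialMeasure P k U1 : Measure (UCfg P k)) = Measure.pi fun b : PBond P k =>
      if b ∈ (axialBonds : Finset (PBond P k)) then Measure.dirac (1 : U1) else (HaarData.haar : Measure U1) := by
  haveI : IsProbabilityMeasure (HaarData.haar : Measure U1) := HaarData.isProb
  set f : PBond P k → U1 → U1 := fun b u => if b ∈ (axialBonds : Finset (PBond P k)) then 1 else u with hfdef
  have hfm : ∀ b, Measurable (f b) := fun b => by
    by_cases hb : b ∈ (axialBonds : Finset (PBond P k))
    · simp only [hfdef, hb, if_true]; exact measurable_const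
    · simp only [hfdef, hb, if_false]; exact measurable_id
  have hf : (fixBonds (axialBonds : Finset (PBond P k)) : GaugeField P k U1 → GaugeField P k U1) = fun U b => f b (U b) := by
    funext U b
    by_cases hb : b ∈ (axialBonds : Finset (PBond P k))
    · rw [fixBonds_apply_of_mem hb]; simp only [hfdef, hb, if_true]
    · rw [fixBonds_apply_of_not_mem hb]; simp only [hfdef, hb, if_false]
  have key : (Measure.pi fun _ : PBond P k => (HaarData.haar : Measure U1)).map (fun (U : PBond P k → U1) b => f b (U b)) =
      Measure.pi fun b => (HaarData.haar : Measure U1).map (f b) :=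
    Measure.pi_map_pi fun b => (hfm b).aemeasurable
  unfold axialMeasure
  rw [hf]
  change (Measure.pi fun _ : PBond P k => (HaarData.haar : Measure U1)).map (fun (U : PBond P k → U1) b => f b (U b)) = _
  rw [key]
  congr 1
  funext b
  by_cases hb : b ∈ (axialBonds : Finset (PBond P k))
  · simp only [hfdef, hb, if_true, Measure.map_const, measure_univ, one_smul]
  · simp only [hfdef, hb, if_false, Measure.map_id']

/-- **THE INTERIOR INDEX SETS OF ONE TERM** — p. 300: *"doing the integrals there with conditioning on Λ^{(k)c}_{10}, Λ^{(k)c*c}_{10}"*; (5.12.8):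
the exterior integral runs over `u^{(j)}|_{Λ^{(j)c*}_{10}}` (`j ≤ k`) and `φ^{(k)}|_{Λ^{(k)c}_{10}}`, the interior measure (5.12.7) over
`A^{(k)″}|_{Λ^{(k)c*c}_{10}}`, `φ^{(k)″}|_{Λ^{(k)}_{10}}` (and (5.12.3) integrates `u^{(j)}|_{Λ^{(j)*}_{10}}`, `j < k`).  DATA: `Ib` = the interior bonds of
`u^{(k)}` (`Λ^{(k)c*c}_{10}`), `Ip j` = those of `u^{(j)}` (`Λ^{(j)c*c}_{10}`), `Ix` = the interior sites of `φ^{(k)}` (`Λ^{(k)}_{10}`); the exterior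
sets are their complements. [cite: BalabanImbrieJaffe1988, (5.12.8) p.303] -/
structure Interior (P : Params) (k : ℕ) where
  /-- interior bonds of the translated gauge field `u^{(k)}` (`Λ^{(k)c*c}_{10}`) -/
  Ib : Finset (PBond P k)
  /-- interior bonds of the previous field `u^{(j)}` (`Λ^{(j)c*c}_{10}`) -/
  Ip : (j : Fin k) → Finset (PBond P j)
  /-- interior sites of `φ^{(k)}` (`Λ^{(k)}_{10}`) -/
  Ix : Finset (Balaban1983to89.Site P k)

namespace Interior

variable (D : Interior P k)

/-! ## §3 Exterior and interior configurations; the split -/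

/-- exterior bond variables of `u^{(k)}`: `u^{(k)}|_{Λ^{(k)c*}_{10}}`. [cite: BalabanImbrieJaffe1988, (5.12.8) p.303] -/
abbrev EU : Type := {b : PBond P k // b ∉ D.Ib} → U1
/-- interior bond variables of `u^{(k)}` (`A^{(k)″}|_{Λ^{(k)c*c}_{10}}` in the chart). [cite: BalabanImbrieJaffe1988, (5.12.7) p.302] -/
abbrev IU : Type := {b : PBond P k // b ∈ D.Ib} → U1
/-- exterior bond variables of `u^{(j)}`: `u^{(j)}|_{Λ^{(j)c*}_{10}}`. [cite: BalabanImbrieJaffe1988, (5.12.8) p.303] -/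
abbrev EPj (j : Fin k) : Type := {b : PBond P j // b ∉ D.Ip j} → U1
/-- interior bond variables of `u^{(j)}`: `u^{(j)}|_{Λ^{(j)*}_{10}}` ((5.12.3)). [cite: BalabanImbrieJaffe1988, (5.12.3) p.301] -/
abbrev IPj (j : Fin k) : Type := {b : PBond P j // b ∈ D.Ip j} → U1
/-- all exterior previous bond variables. [cite: BalabanImbrieJaffe1988, (5.12.8) p.303] -/
abbrev EP : Type := (j : Fin k) → D.EPj j
/-- all interior previous bond variables. [cite: BalabanImbrieJaffe1988, (5.12.3) p.301] -/
abbrev IP : Type := (j : Fin k) → D.IPj j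
/-- exterior site variables of `φ^{(k)}`: `φ^{(k)}|_{Λ^{(k)c}_{10}}`. [cite: BalabanImbrieJaffe1988, (5.12.8) p.303] -/
abbrev EX : Type := {x : Balaban1983to89.Site P k // x ∉ D.Ix} → ℂ
/-- interior site variables of `φ^{(k)}`: `φ^{(k)″}|_{Λ^{(k)}_{10}}`. [cite: BalabanImbrieJaffe1988, (5.12.7) p.302] -/
abbrev IX : Type := {x : Balaban1983to89.Site P k // x ∈ D.Ix} → ℂ
/-- THE EXTERIOR CONFIGURATION of one term (all exterior variables). [cite: BalabanImbrieJaffe1988, (5.12.8) p.303] -/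
abbrev Ext : Type := D.EU × (D.EP × D.EX)
/-- THE INTERIOR CONFIGURATION of one term (all interior variables). [cite: BalabanImbrieJaffe1988, (5.12.7) p.302] -/
abbrev Int : Type := D.IU × (D.IP × D.IX)

/-- the split of `u^{(k)}` into exterior and interior bond variables. [cite: BalabanImbrieJaffe1988, (5.12.8) p.303] -/
def splitU : UCfg P k ≃ᵐ D.EU × D.IU :=
  (MeasurableEquiv.piEquivPiSubtypeProd (fun _ : PBond P k => U1) (· ∈ D.Ib)).trans MeasurableEquiv.prodComm

/-- the split of `u^{(j)}`. [cite: BalabanImbrieJaffe1988, (5.12.8) p.303] -/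
def splitPj (j : Fin k) : (PBond P j → U1) ≃ᵐ D.EPj j × D.IPj j :=
  (MeasurableEquiv.piEquivPiSubtypeProd (fun _ : PBond P j => U1) (· ∈ D.Ip j)).trans MeasurableEquiv.prodComm

/-- the split of all previous fields. [cite: BalabanImbrieJaffe1988, (5.12.8) p.303] -/
def splitP : PCfg P k ≃ᵐ D.EP × D.IP :=
  (MeasurableEquiv.piCongrRight fun j => D.splitPj j).trans piProdSplit

/-- the split of `φ^{(k)}` into exterior and interior site variables. [cite: BalabanImbrieJaffe1988, (5.12.8) p.303] -/
def splitX : HiggsField P k ≃ᵐ D.EX × D.IX :=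
  (MeasurableEquiv.piEquivPiSubtypeProd (fun _ : Balaban1983to89.Site P k => ℂ) (· ∈ D.Ix)).trans MeasurableEquiv.prodComm

/-- **THE EXTERIOR/INTERIOR SPLIT OF ONE TERM'S CONFIGURATION**: `q = (u^{(k)}, {u^{(j)}}, φ^{(k)}) ↦ ((exterior variables), (interior variables))`.
[cite: BalabanImbrieJaffe1988, (5.12.8) p.303] -/
def split : Cfg P k ≃ᵐ D.Ext × D.Int :=
  ((D.splitU).prodCongr (((D.splitP).prodCongr D.splitX).trans prodProdProdComm)).trans prodProdProdComm

/-- the inverse of the split: reassembling a configuration from its exterior and interior variables. [cite: BalabanImbrieJaffe1988, (5.12.8) p.303] -/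
def glue (e : D.Ext) (i : D.Int) : Cfg P k := (D.split).symm (e, i)

/-- the frozen values of the interior variables (`1` for bond variables, `0` for site variables): a base point of `Int`.
[cite: BalabanImbrieJaffe1988, (5.12.8) p.303] -/
def base : D.Int := (fun _ => 1, (fun _ _ => 1, fun _ => 0))

/-- **FREEZING THE INTERIOR VARIABLES** of a configuration (`u_b ↦ 1` on interior bonds, `φ(x) ↦ 0` on interior sites): the exterior bracket of
(5.12.8) is a function of `freeze q` — i.e. of the exterior variables only. [cite: BalabanImbrieJaffe1988, (5.12.8) p.303] -/
def freeze (q : Cfg P k) : Cfg P k :=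
  (fun b => if b ∈ D.Ib then 1 else q.1 b, (fun j b => if b ∈ D.Ip j then 1 else q.2.1 j b, fun x => if x ∈ D.Ix then 0 else q.2.2 x))

/-- kernel: `freeze` on the gauge field is r18's freezing `U[Ib := 1]` (`fixBonds`). [cite: BalabanImbrieJaffe1988, (5.12.8) p.303] -/
theorem freeze_fst {inst : DecidableEq (PBond P k)} (q : Cfg P k) : (D.freeze q).1 = @fixBonds P k U1 _ inst D.Ib q.1 := by
  funext b
  by_cases hb : b ∈ D.Ib
  · rw [fixBonds_apply_of_mem hb]; simp only [freeze, hb, if_true]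
  · rw [fixBonds_apply_of_not_mem hb]; simp only [freeze, hb, if_false]

/-- kernel: exterior part of the split of `u^{(k)}`. [cite: BalabanImbrieJaffe1988, (5.12.8) p.303] -/
theorem splitU_fst (U : UCfg P k) (b : {b : PBond P k // b ∉ D.Ib}) : (D.splitU U).1 b = U b.1 := rfl
/-- kernel: interior part of the split of `u^{(k)}`. [cite: BalabanImbrieJaffe1988, (5.12.8) p.303] -/
theorem splitU_snd (U : UCfg P k) (b : {b : PBond P k // b ∈ D.Ib}) : (D.splitU U).2 b = U b.1 := rfl
/-- kernel: exterior part of the split of `{u^{(j)}}`. [cite: BalabanImbrieJaffe1988, (5.12.8) p.303] -/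
theorem splitP_fst (p : PCfg P k) (j : Fin k) (b : {b : PBond P j // b ∉ D.Ip j}) : (D.splitP p).1 j b = p j b.1 := rfl
/-- kernel: interior part of the split of `{u^{(j)}}`. [cite: BalabanImbrieJaffe1988, (5.12.8) p.303] -/
theorem splitP_snd (p : PCfg P k) (j : Fin k) (b : {b : PBond P j // b ∈ D.Ip j}) : (D.splitP p).2 j b = p j b.1 := rfl
/-- kernel: exterior part of the split of `φ^{(k)}`. [cite: BalabanImbrieJaffe1988, (5.12.8) p.303] -/
theorem splitX_fst (φ : HiggsField P k) (x : {x : Balaban1983to89.Site P k // x ∉ D.Ix}) : (D.splitX φ).1 x = φ x.1 := rfl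
/-- kernel: interior part of the split of `φ^{(k)}`. [cite: BalabanImbrieJaffe1988, (5.12.8) p.303] -/
theorem splitX_snd (φ : HiggsField P k) (x : {x : Balaban1983to89.Site P k // x ∈ D.Ix}) : (D.splitX φ).2 x = φ x.1 := rfl

/-- kernel: the split of a configuration, componentwise. [cite: BalabanImbrieJaffe1988, (5.12.8) p.303] -/
theorem split_apply (q : Cfg P k) :
    D.split q = (((D.splitU q.1).1, ((D.splitP q.2.1).1, (D.splitX q.2.2).1)), ((D.splitU q.1).2, ((D.splitP q.2.1).2, (D.splitX q.2.2).2))) := rfl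

/-- kernel: `split (glue e i) = (e, i)`. [cite: BalabanImbrieJaffe1988, (5.12.8) p.303] -/
theorem split_glue (e : D.Ext) (i : D.Int) : D.split (D.glue e i) = (e, i) := (D.split).apply_symm_apply (e, i)

/-- kernel: `glue` reassembles a split configuration. [cite: BalabanImbrieJaffe1988, (5.12.8) p.303] -/
theorem glue_split (q : Cfg P k) : D.glue (D.split q).1 (D.split q).2 = q := (D.split).symm_apply_apply q

/-- kernel: the gauge field of a glued configuration off the interior bonds is the exterior variable. [cite: BalabanImbrieJaffe1988, (5.12.8) p.303] -/
theorem glue_fst_of_not_mem (e : D.Ext) (i : D.Int) {b : PBond P k} (hb : b ∉ D.Ib) : (D.glue e i).1 b = e.1 ⟨b, hb⟩ := by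
  have h := congrArg (fun z : D.Ext × D.Int => z.1.1 ⟨b, hb⟩) (D.split_glue e i)
  simpa only [split_apply, splitU_fst] using h

/-- kernel: … on the interior bonds it is the interior variable. [cite: BalabanImbrieJaffe1988, (5.12.7) p.302] -/
theorem glue_fst_of_mem (e : D.Ext) (i : D.Int) {b : PBond P k} (hb : b ∈ D.Ib) : (D.glue e i).1 b = i.1 ⟨b, hb⟩ := by
  have h := congrArg (fun z : D.Ext × D.Int => z.2.1 ⟨b, hb⟩) (D.split_glue e i)
  simpa only [split_apply, splitU_snd] using h

/-- kernel: previous fields of a glued configuration off the interior bonds. [cite: BalabanImbrieJaffe1988, (5.12.8) p.303] -/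
theorem glue_prev_of_not_mem (e : D.Ext) (i : D.Int) (j : Fin k) {b : PBond P j} (hb : b ∉ D.Ip j) :
    (D.glue e i).2.1 j b = e.2.1 j ⟨b, hb⟩ := by
  have h := congrArg (fun z : D.Ext × D.Int => z.1.2.1 j ⟨b, hb⟩) (D.split_glue e i)
  simpa only [split_apply, splitP_fst] using h

/-- kernel: previous fields of a glued configuration on the interior bonds. [cite: BalabanImbrieJaffe1988, (5.12.3) p.301] -/
theorem glue_prev_of_mem (e : D.Ext) (i : D.Int) (j : Fin k) {b : PBond P j} (hb : b ∈ D.Ip j) :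
    (D.glue e i).2.1 j b = i.2.1 j ⟨b, hb⟩ := by
  have h := congrArg (fun z : D.Ext × D.Int => z.2.2.1 j ⟨b, hb⟩) (D.split_glue e i)
  simpa only [split_apply, splitP_snd] using h

/-- kernel: the scalar field of a glued configuration off the interior sites. [cite: BalabanImbrieJaffe1988, (5.12.8) p.303] -/
theorem glue_higgs_of_not_mem (e : D.Ext) (i : D.Int) {x : Balaban1983to89.Site P k} (hx : x ∉ D.Ix) :
    (D.glue e i).2.2 x = e.2.2 ⟨x, hx⟩ := by
  have h := congrArg (fun z : D.Ext × D.Int => z.1.2.2 ⟨x, hx⟩) (D.split_glue e i)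
  simpa only [split_apply, splitX_fst] using h

/-- kernel: … on the interior sites. [cite: BalabanImbrieJaffe1988, (5.12.7) p.302] -/
theorem glue_higgs_of_mem (e : D.Ext) (i : D.Int) {x : Balaban1983to89.Site P k} (hx : x ∈ D.Ix) : (D.glue e i).2.2 x = i.2.2 ⟨x, hx⟩ := by
  have h := congrArg (fun z : D.Ext × D.Int => z.2.2.2 ⟨x, hx⟩) (D.split_glue e i)
  simpa only [split_apply, splitX_snd] using h

/-- **Freezing keeps the exterior variables and sets the interior ones to the base point**: `split (freeze q) = ((split q).1, base)`.
[cite: BalabanImbrieJaffe1988, (5.12.8) p.303] -/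
theorem split_freeze (q : Cfg P k) : D.split (D.freeze q) = ((D.split q).1, D.base) := by
  rw [split_apply, split_apply]
  refine Prod.ext (Prod.ext ?_ (Prod.ext ?_ ?_)) (Prod.ext ?_ (Prod.ext ?_ ?_))
  · funext b; simp only [splitU_fst, freeze, if_neg b.2]
  · funext j b; simp only [splitP_fst, freeze, if_neg b.2]
  · funext x; simp only [splitX_fst, freeze, if_neg x.2]
  · funext b; simp only [splitU_snd, freeze, if_pos b.2, base]
  · funext j b; simp only [splitP_snd, freeze, if_pos b.2, base]
  · funext x; simp only [splitX_snd, freeze, if_pos x.2, base]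

/-- **`freeze (glue e i) = glue e base`**: the frozen configuration depends on the exterior variables only. [cite: BalabanImbrieJaffe1988, (5.12.8) p.303] -/
theorem freeze_glue (e : D.Ext) (i : D.Int) : D.freeze (D.glue e i) = D.glue e D.base := by
  apply (D.split).injective
  rw [split_freeze, split_glue, split_glue]

/-- kernel: freezing twice is freezing once. [cite: BalabanImbrieJaffe1988, (5.12.8) p.303] -/
theorem freeze_freeze (q : Cfg P k) : D.freeze (D.freeze q) = D.freeze q := by
  apply (D.split).injective
  rw [split_freeze, split_freeze]

/-- kernel: `freeze q = glue (split q).1 base`. [cite: BalabanImbrieJaffe1988, (5.12.8) p.303] -/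
theorem freeze_eq_glue (q : Cfg P k) : D.freeze q = D.glue (D.split q).1 D.base := by
  apply (D.split).injective
  rw [split_freeze, split_glue]

/-- kernel: `freeze` is measurable. [cite: BalabanImbrieJaffe1988, (5.12.8) p.303] -/
theorem measurable_freeze : Measurable D.freeze := by
  have h : D.freeze = fun q => (D.split).symm ((D.split q).1, D.base) := by
    funext q; rw [freeze_eq_glue]; rfl
  rw [h]
  exact (D.split).symm.measurable.comp ((D.split).measurable.fst.prodMk measurable_const)

/-! ## §4 The exterior and interior measures; the split preserves the configuration measure -/

variable (m : PBond P k → Measure U1)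

/-- the exterior law of `u^{(k)}`: product of the one-bond laws over the exterior bonds (`du^{(k)}|_{Λ^{(k)c*}_{10}}`).
[cite: BalabanImbrieJaffe1988, (5.12.8) p.303] -/
def μEU : Measure D.EU := Measure.pi fun b : {b : PBond P k // b ∉ D.Ib} => m b.1
/-- the interior law of `u^{(k)}` (`du^{(k)}|_{Λ^{(k)c*c}_{10}}`, the `dA^{(k)″}` of (5.12.7) before the chart). [cite: BalabanImbrieJaffe1988, (5.12.7) p.302] -/
def μIU : Measure D.IU := Measure.pi fun b : {b : PBond P k // b ∈ D.Ib} => m b.1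
/-- the exterior law of the previous fields: `Π_{j<k} du^{(j)}|_{Λ^{(j)c*}_{10}}` (Haar). [cite: BalabanImbrieJaffe1988, (5.12.8) p.303] -/
def μEP : Measure D.EP := Measure.pi fun j => Measure.pi fun _ : {b : PBond P j // b ∉ D.Ip j} => (HaarData.haar : Measure U1)
/-- the interior law of the previous fields: `Π_{j<k} du^{(j)}|_{Λ^{(j)*}_{10}}` ((5.12.3)). [cite: BalabanImbrieJaffe1988, (5.12.3) p.301] -/
def μIP : Measure D.IP := Measure.pi fun j => Measure.pi fun _ : {b : PBond P j // b ∈ D.Ip j} => (HaarData.haar : Measure U1)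
/-- **THE EXTERIOR MEASURE of line 1 of (5.12.8)**: `Π_{j=0}^{k} du^{(j)}|_{Λ^{(j)c*}_{10}} dφ^{(k)}|_{Λ^{(k)c}_{10}}` (the `u^{(k)}`-factor with the
one-bond laws `m`: Haar, or Dirac at `1` on the tree bonds for `δ_{Ax}`). [cite: BalabanImbrieJaffe1988, (5.12.8) p.303] -/
def μExt : Measure D.Ext := (D.μEU m).prod (D.μEP.prod (volume : Measure D.EX))
/-- **THE INTERIOR MEASURE** `du^{(k)}|_{Λ^{(k)c*c}_{10}} Π_{j<k}du^{(j)}|_{Λ^{(j)*}_{10}} dφ^{(k)}|_{Λ^{(k)}_{10}}` — the flat measure that (5.12.7)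
re-weights and normalizes (and whose `u^{(j)}`-part (5.12.3) integrates). [cite: BalabanImbrieJaffe1988, (5.12.7) p.302] -/
def μInt : Measure D.Int := (D.μIU m).prod (D.μIP.prod (volume : Measure D.IX))

/-- kernel (plumbing): the exterior `u^{(k)}`-law is sigma-finite. [cite: BalabanImbrieJaffe1988, (5.12.8) p.303] -/
instance sigmaFinite_μEU [∀ b, SigmaFinite (m b)] : SigmaFinite (D.μEU m) := by unfold μEU; infer_instance
/-- kernel (plumbing): the interior `u^{(k)}`-law is sigma-finite. [cite: BalabanImbrieJaffe1988, (5.12.7) p.302] -/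
instance sigmaFinite_μIU [∀ b, SigmaFinite (m b)] : SigmaFinite (D.μIU m) := by unfold μIU; infer_instance
/-- kernel (plumbing): the interior `u^{(k)}`-law of probability one-bond laws is a probability measure. [cite: BalabanImbrieJaffe1988, (5.12.7) p.302] -/
instance isProbabilityMeasure_μIU [∀ b, IsProbabilityMeasure (m b)] : IsProbabilityMeasure (D.μIU m) := by unfold μIU; infer_instance
/-- kernel (plumbing): the exterior previous-field law is sigma-finite. [cite: BalabanImbrieJaffe1988, (5.12.8) p.303] -/
instance sigmaFinite_μEP : SigmaFinite D.μEP := by unfold μEP; infer_instance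
/-- kernel (plumbing): the interior previous-field law is a probability measure. [cite: BalabanImbrieJaffe1988, (5.12.3) p.301] -/
instance isProbabilityMeasure_μIP : IsProbabilityMeasure D.μIP := by
  haveI := (HaarData.isProb : IsProbabilityMeasure (HaarData.haar : Measure U1))
  unfold μIP; infer_instance
/-- kernel (plumbing): s-finiteness of the exterior measure. [cite: BalabanImbrieJaffe1988, (5.12.8) p.303] -/
instance sFinite_μExt [∀ b, SigmaFinite (m b)] : SFinite (D.μExt m) := by unfold μExt; infer_instance
/-- kernel (plumbing): s-finiteness of the interior measure. [cite: BalabanImbrieJaffe1988, (5.12.7) p.302] -/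
instance sFinite_μInt [∀ b, SigmaFinite (m b)] : SFinite (D.μInt m) := by unfold μInt; infer_instance
/-- kernel (plumbing): the interior measure is non-zero. [cite: BalabanImbrieJaffe1988, (5.12.7) p.302] -/
instance neZero_μInt [∀ b, IsProbabilityMeasure (m b)] : NeZero (D.μInt m) := by
  refine ⟨fun h => ?_⟩
  have h1 := congrArg (fun μ : Measure D.Int => μ Set.univ) h
  simp only [Measure.coe_zero, Pi.zero_apply] at h1
  unfold μInt at h1
  rw [← Set.univ_prod_univ, Measure.prod_prod, ← Set.univ_prod_univ, Measure.prod_prod, measure_univ, measure_univ,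
    one_mul, one_mul] at h1
  exact (Measure.measure_univ_ne_zero.mpr (NeZero.ne (volume : Measure D.IX))) h1

/-- kernel: the split of `u^{(k)}` carries `Π_b m_b` to `μEU ⊗ μIU`. [cite: BalabanImbrieJaffe1988, (5.12.8) p.303] -/
theorem measurePreserving_splitU [∀ b, SigmaFinite (m b)] :
    MeasurePreserving D.splitU (Measure.pi m) ((D.μEU m).prod (D.μIU m)) :=
  (Measure.measurePreserving_swap).comp (measurePreserving_piEquivPiSubtypeProd m (· ∈ D.Ib))

/-- kernel: the split of `u^{(j)}` carries `𝒟u^{(j)}` to the product of the exterior and interior Haar products.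
[cite: BalabanImbrieJaffe1988, (5.12.8) p.303] -/
theorem measurePreserving_splitPj (j : Fin k) :
    MeasurePreserving (D.splitPj j) (Measure.pi fun _ : PBond P j => (HaarData.haar : Measure U1))
      ((Measure.pi fun _ : {b : PBond P j // b ∉ D.Ip j} => (HaarData.haar : Measure U1)).prod
        (Measure.pi fun _ : {b : PBond P j // b ∈ D.Ip j} => (HaarData.haar : Measure U1))) :=
  (Measure.measurePreserving_swap).comp
    (measurePreserving_piEquivPiSubtypeProd (fun _ : PBond P j => (HaarData.haar : Measure U1)) (· ∈ D.Ip j))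

/-- kernel: the split of the previous fields carries `Π_{j<k}𝒟u^{(j)}` to `μEP ⊗ μIP`. [cite: BalabanImbrieJaffe1988, (5.12.8) p.303] -/
theorem measurePreserving_splitP : MeasurePreserving D.splitP (prevPi P k) (D.μEP.prod D.μIP) := by
  have h1 := measurePreserving_pi (fun j : Fin k => Measure.pi fun _ : PBond P j => (HaarData.haar : Measure U1))
    (fun j : Fin k => (Measure.pi fun _ : {b : PBond P j // b ∉ D.Ip j} => (HaarData.haar : Measure U1)).prod
      (Measure.pi fun _ : {b : PBond P j // b ∈ D.Ip j} => (HaarData.haar : Measure U1)))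
    (fun j => D.measurePreserving_splitPj j)
  have h2 := measurePreserving_piProdSplit
    (fun j : Fin k => Measure.pi fun _ : {b : PBond P j // b ∉ D.Ip j} => (HaarData.haar : Measure U1))
    (fun j : Fin k => Measure.pi fun _ : {b : PBond P j // b ∈ D.Ip j} => (HaarData.haar : Measure U1))
  exact h2.comp h1

/-- kernel: the split of `φ^{(k)}` carries `𝒟φ^{(k)}` (Lebesgue) to the product of the exterior and interior Lebesgue measures.
[cite: BalabanImbrieJaffe1988, (5.12.8) p.303] -/
theorem measurePreserving_splitX :
    MeasurePreserving D.splitX (volume : Measure (HiggsField P k)) ((volume : Measure D.EX).prod (volume : Measure D.IX)) :=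
  (Measure.measurePreserving_swap).comp
    (volume_preserving_piEquivPiSubtypeProd (fun _ : Balaban1983to89.Site P k => ℂ) (· ∈ D.Ix))

/-- **THE SPLIT PRESERVES THE CONFIGURATION MEASURE**: `(Π_b m_b) ⊗ Π_{j<k}𝒟u^{(j)} ⊗ 𝒟φ^{(k)} ≅ μExt ⊗ μInt` along `split` — the product structure
that makes *"doing the integrals there with conditioning on Λ^{(k)c}_{10}, Λ^{(k)c*c}_{10}"* an identity (Fubini over exterior × interior).
[cite: BalabanImbrieJaffe1988, (5.12.8) p.303] -/
theorem measurePreserving_split [∀ b, SigmaFinite (m b)] :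
    MeasurePreserving D.split (cfgMeasure (Measure.pi m)) ((D.μExt m).prod (D.μInt m)) := by
  have hPX := (D.measurePreserving_splitP).prod D.measurePreserving_splitX
  have hPX' := (measurePreserving_prodProdProdComm D.μEP D.μIP (volume : Measure D.EX) (volume : Measure D.IX)).comp hPX
  have hAll := (D.measurePreserving_splitU m).prod hPX'
  exact (measurePreserving_prodProdProdComm (D.μEU m) (D.μIU m) (D.μEP.prod (volume : Measure D.EX))
    (D.μIP.prod (volume : Measure D.IX))).comp hAll

/-- **Fubini over exterior × interior**: `∫ F d(cfgMeasure) = ∫_{Ext} ∫_{Int} F(glue e i) dμInt dμExt` for an integrable `F`.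
[cite: BalabanImbrieJaffe1988, (5.12.8) p.303] -/
theorem integral_cfg_eq_ext_int [∀ b, SigmaFinite (m b)] {E : Type*} [NormedAddCommGroup E] [NormedSpace ℝ E]
    {F : Cfg P k → E} (hF : Integrable F (cfgMeasure (Measure.pi m))) :
    ∫ q, F q ∂cfgMeasure (Measure.pi m) = ∫ e, ∫ i, F (D.glue e i) ∂D.μInt m ∂D.μExt m := by
  have hΦ := D.measurePreserving_split m
  have hF' : Integrable (fun z : D.Ext × D.Int => F ((D.split).symm z)) ((D.μExt m).prod (D.μInt m)) :=
    ((hΦ.symm D.split).integrable_comp hF.aestronglyMeasurable).mpr hF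
  rw [← (hΦ.symm D.split).integral_comp' (g := F), integral_prod _ hF']
  rfl

/-- **The integrand transported to exterior × interior variables is integrable** iff it is for the configuration measure.
[cite: BalabanImbrieJaffe1988, (5.12.8) p.303] -/
theorem integrable_glue_iff [∀ b, SigmaFinite (m b)] {E : Type*} [NormedAddCommGroup E] [NormedSpace ℝ E] {F : Cfg P k → E} :
    Integrable (fun z : D.Ext × D.Int => F (D.glue z.1 z.2)) ((D.μExt m).prod (D.μInt m)) ↔ Integrable F (cfgMeasure (Measure.pi m)) := by
  have hΦ := (D.measurePreserving_split m).symm D.split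
  have e : (fun z : D.Ext × D.Int => F (D.glue z.1 z.2)) = F ∘ (D.split).symm := by
    funext z; rfl
  rw [e]
  exact hΦ.integrable_comp_emb (D.split).symm.measurableEmbedding

/-! ## §5 The exterior measure and the fibre laws on the full configuration space -/

/-- **THE EXTERIOR MEASURE OF (5.12.8) ON THE CONFIGURATION SPACE**: `Π_{j=0}^{k} du^{(j)}|_{Λ^{(j)c*}_{10}} dφ^{(k)}|_{Λ^{(k)c}_{10}}`, the interior
variables carried as frozen dummies (`glue e base`). [cite: BalabanImbrieJaffe1988, (5.12.8) p.303] -/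
def extMeasure : Measure (Cfg P k) := (D.μExt m).map fun e => D.glue e D.base

/-- **THE FIBRE LAW over an exterior configuration**: a measure `μ` on the interior variables read on the configuration space (`glue e ·`); with
`μ = 𝒩⁻¹·W·μInt` this is the conditional measure `dμ^{(k)}_{Λ^{(k)}_{10}}` of (5.12.7)–(5.12.8). [cite: BalabanImbrieJaffe1988, (5.12.7) p.302] -/
def fibreMeasure (μ : Measure D.Int) (e : D.Ext) : Measure (Cfg P k) := μ.map (D.glue e)

/-- kernel: `e ↦ glue e base` is a measurable embedding. [cite: BalabanImbrieJaffe1988, (5.12.8) p.303] -/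
theorem measurableEmbedding_glue_base : MeasurableEmbedding fun e : D.Ext => D.glue e D.base :=
  (D.split).symm.measurableEmbedding.comp (measurableEmbedding_prod_mk_right D.base)

/-- kernel: `glue e` is a measurable embedding of the interior variables. [cite: BalabanImbrieJaffe1988, (5.12.7) p.302] -/
theorem measurableEmbedding_glue (e : D.Ext) : MeasurableEmbedding (D.glue e) :=
  (D.split).symm.measurableEmbedding.comp (measurableEmbedding_prodMk_left e)

/-- **Integration against the exterior measure** = integration over the exterior variables with the interior ones frozen.
[cite: BalabanImbrieJaffe1988, (5.12.8) p.303] -/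
theorem integral_extMeasure {E : Type*} [NormedAddCommGroup E] [NormedSpace ℝ E] (F : Cfg P k → E) :
    ∫ q, F q ∂D.extMeasure m = ∫ e, F (D.glue e D.base) ∂D.μExt m :=
  (D.measurableEmbedding_glue_base).integral_map F

/-- **Integration against a fibre law** = integration over the interior variables at the given exterior ones. [cite: BalabanImbrieJaffe1988, (5.12.7) p.302] -/
theorem integral_fibreMeasure {E : Type*} [NormedAddCommGroup E] [NormedSpace ℝ E] (μ : Measure D.Int) (e : D.Ext) (G : Cfg P k → E) :
    ∫ q, G q ∂D.fibreMeasure μ e = ∫ i, G (D.glue e i) ∂μ :=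
  (D.measurableEmbedding_glue e).integral_map G

/-- **Under the exterior measure the interior variables ARE frozen**: an integrand may be read at `freeze q` instead of `q`.
[cite: BalabanImbrieJaffe1988, (5.12.8) p.303] -/
theorem integral_extMeasure_freeze {E : Type*} [NormedAddCommGroup E] [NormedSpace ℝ E] (F : Cfg P k → Cfg P k → E) :
    ∫ q, F (D.freeze q) q ∂D.extMeasure m = ∫ q, F q q ∂D.extMeasure m := by
  rw [integral_extMeasure, integral_extMeasure]
  refine integral_congr_ae (Filter.Eventually.of_forall fun e => ?_)
  simp only [freeze_glue]

/-- A fibre law of a probability measure is a probability measure. [cite: BalabanImbrieJaffe1988, (5.12.7) p.302] -/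
instance isProbabilityMeasure_fibreMeasure (μ : Measure D.Int) [IsProbabilityMeasure μ] (e : D.Ext) :
    IsProbabilityMeasure (D.fibreMeasure μ e) :=
  Measure.isProbabilityMeasure_map (D.measurableEmbedding_glue e).measurable.aemeasurable

end Interior

end

end Literature.MathematicalPhysics.QuantumFieldTheory.BalabanImbrieJaffe1984to88.BIJ88Eq5128Split
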